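import Mathlib
import HarnessLib
import Literature.AlgebraicGeometry.HyperbolicPolynomials.SpectrahedralShadow
import Summits.ValiantsHypothesis.ValiantsHypothesis.Theorems.PermanentalConesHyperbolicVPShadowStubLowEffGlue

/-!
# ValiantsHypothesis / PermanentalCones — `HyperbolicVPShadow`, glue of the Hanselka–Kummer layer

Route `PermanentalCones`, item `stmt-ValiantsHypothesis-8655` (crux `HyperbolicVPShadow`), line
`birth`, stub `stub_hkLayer_glue`.

The crux is reduced in the skeleton to linear pencils `P : ℝⁿ →ₗ Mat_N(ℝ)` all of whose values
have only real eigenvalues, and their closed nonnegative-spectrum cones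
`{x : ∀ τ > 0, det (P x + τ·1) ≠ 0}`. This file proves the GLUE of the Hanselka–Kummer layer
(`N = 3`, `dim span (1, range P) ≤ 4`): from the four neighbouring statements, taken verbatim as
hypotheses —

* T₄: real-spectrum quaternary pencils `Σ Xᵢ bᵢ` of `3 × 3` matrices with `Σ eᵢ bᵢ = 1` have
  `det (Σ Xᵢ bᵢ)` a quaternary hyperbolic cubic form normalised at `e`;
* HKₑ: a quaternary hyperbolic cubic normalised at `e` is `det (Σ vᵢ Aᵢ)` for hermitian `3 × 3`
  matrices `A₀, …, A₃` with `Σ eᵢ Aᵢ = 1` (Hanselka–Kummer, in a general direction `e`);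
* R: a hermitian linear pencil `H` of size `M` realifies to a real SYMMETRIC linear pencil `L` of
  size `2M` with `det (L x + τ·1) = det (H x + τ·1) · conj (det (H x + τ·1))`;
* S⁺: a symmetric determinantal identity `det (L x + τ·1) = det (P x + τ·1)ᵏ`, `k ≠ 0`, makes the
  cone of `P` a spectrahedral shadow of the size of `L` —

every such pencil `P` of real `3 × 3` matrices for which `V := span (1, range P)` has dimension
`≤ 4` has a closed nonnegative-spectrum cone that is a spectrahedral shadow of size `6`.

Proof: pad a basis of `V` to a frame `b₀, …, b₃ ∈ V` with a LINEAR coordinate map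
`coord : V →ₗ ℝ⁴`, `Σ (coord v)ᵢ bᵢ = v` (`permanentalCones_exists_frame_of_finrank_le`); all of
`V` has real spectrum (`permanentalCones_map_smul_one_add_sub`); with `e := coord 1` and
`c := coord ∘ P`, T₄ gives the form `F`, HKₑ gives hermitian `A₀, …, A₃` with `Σ eᵢAᵢ = 1` and
`F(v) = det (Σ vᵢAᵢ)`; the `ℝ`-linear hermitian pencil `H x := Σ cᵢ(x) Aᵢ` satisfies
`det (H x + τ·1) = F(c x + τe) = det (P x + τ·1)` (a real number), so R gives a symmetric `L` of
size `2·3` with `det (L x + τ·1) = det (P x + τ·1)²`, and S⁺ (`k = 2`) concludes. All folklore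
linear algebra.
-/

set_option linter.dupNamespace false

noncomputable section

namespace Summit.ValiantsHypothesis.ValiantsHypothesis.Theorems

open Matrix
open Literature.AlgebraicGeometry.HyperbolicPolynomials

/-- **Glue of the Hanselka–Kummer layer** (crux `HyperbolicVPShadow`): from stubs T₄ (real-spectrum
quaternary pencils of `3 × 3` matrices are hyperbolic cubic forms), HKₑ (hyperbolic quaternary
cubics have normalised hermitian determinantal representations), R (realification of a hermitian
linear pencil to a symmetric one of double size, squaring the determinant) and S⁺ (a symmetric
determinantal power identity makes the cone a spectrahedral shadow) — all taken verbatim as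
hypotheses — every linear pencil `P` of real `3 × 3` matrices with only real eigenvalues whose
values together with the identity span a space of dimension `≤ 4` has a closed
nonnegative-spectrum cone that is a spectrahedral shadow of size `6`. [folklore] -/
theorem stub_hkLayer_glue :
    (∀ (b : Fin 4 → Matrix (Fin 3) (Fin 3) ℝ) (e : Fin 4 → ℝ),
      ∑ i, e i • b i = 1 →
      (∀ (w : Fin 4 → ℝ) (z : ℂ),
        ((∑ i, w i • b i).map (algebraMap ℝ ℂ) - z • (1 : Matrix (Fin 3) (Fin 3) ℂ)).det = 0 →
          z.im = 0) →
      ∃ F : MvPolynomial (Fin 4) ℝ, F.IsHomogeneous 3 ∧ MvPolynomial.eval e F = 1 ∧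
        (∀ w : Fin 4 → ℝ, Multiset.card (MvPolynomial.aeval
          (fun i => Polynomial.C (w i) - Polynomial.C (e i) * Polynomial.X) F).roots = 3) ∧
        ∀ v : Fin 4 → ℝ, MvPolynomial.eval v F = (∑ i, v i • b i).det) →
    (∀ (F : MvPolynomial (Fin 4) ℝ) (e : Fin 4 → ℝ), F.IsHomogeneous 3 →
      MvPolynomial.eval e F = 1 →
      (∀ w : Fin 4 → ℝ, Multiset.card (MvPolynomial.aeval
          (fun i => Polynomial.C (w i) - Polynomial.C (e i) * Polynomial.X) F).roots = 3) →
      ∃ A : Fin 4 → Matrix (Fin 3) (Fin 3) ℂ, (∀ i, (A i).IsHermitian) ∧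
        ∑ i, (e i : ℂ) • A i = 1 ∧
        ∀ v : Fin 4 → ℝ, ((MvPolynomial.eval v F : ℝ) : ℂ) = (∑ i, (v i : ℂ) • A i).det) →
    (∀ (n M : ℕ) (H : (Fin n → ℝ) →ₗ[ℝ] Matrix (Fin M) (Fin M) ℂ),
      (∀ x : Fin n → ℝ, (H x).IsHermitian) →
      ∃ L : (Fin n → ℝ) →ₗ[ℝ] Matrix (Fin (2 * M)) (Fin (2 * M)) ℝ,
        (∀ x : Fin n → ℝ, (L x).IsSymm) ∧
        ∀ (x : Fin n → ℝ) (τ : ℝ),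
          (algebraMap ℝ ℂ) ((L x + τ • (1 : Matrix (Fin (2 * M)) (Fin (2 * M)) ℝ)).det) =
            (H x + (τ : ℂ) • (1 : Matrix (Fin M) (Fin M) ℂ)).det *
              star ((H x + (τ : ℂ) • (1 : Matrix (Fin M) (Fin M) ℂ)).det)) →
    (∀ (n N M k : ℕ) (P : (Fin n → ℝ) →ₗ[ℝ] Matrix (Fin N) (Fin N) ℝ)
      (L : (Fin n → ℝ) →ₗ[ℝ] Matrix (Fin M) (Fin M) ℝ), k ≠ 0 →
      (∀ x : Fin n → ℝ, (L x).IsSymm) →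
      (∀ (x : Fin n → ℝ) (τ : ℝ), (L x + τ • (1 : Matrix (Fin M) (Fin M) ℝ)).det =
        ((P x + τ • (1 : Matrix (Fin N) (Fin N) ℝ)).det) ^ k) →
      Literature.AlgebraicGeometry.HyperbolicPolynomials.IsSpectrahedralShadowOfSize
        {x : Fin n → ℝ | ∀ τ : ℝ, 0 < τ → (P x + τ • (1 : Matrix (Fin N) (Fin N) ℝ)).det ≠ 0} M) →
    ∀ (n : ℕ) (P : (Fin n → ℝ) →ₗ[ℝ] Matrix (Fin 3) (Fin 3) ℝ),
      (∀ (x : Fin n → ℝ) (z : ℂ),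
        ((P x).map (algebraMap ℝ ℂ) - z • (1 : Matrix (Fin 3) (Fin 3) ℂ)).det = 0 → z.im = 0) →
      Module.finrank ℝ (Submodule.span ℝ
        (insert (1 : Matrix (Fin 3) (Fin 3) ℝ) (Set.range P))) ≤ 4 →
      Literature.AlgebraicGeometry.HyperbolicPolynomials.IsSpectrahedralShadowOfSize
        {x : Fin n → ℝ | ∀ τ : ℝ, 0 < τ → (P x + τ • (1 : Matrix (Fin 3) (Fin 3) ℝ)).det ≠ 0} 6 := by
  intro hT hHK hR hS n P hP hdim
  classical
  -- the space `V = span (1, range P)`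
  set V : Submodule ℝ (Matrix (Fin 3) (Fin 3) ℝ) :=
    Submodule.span ℝ (insert (1 : Matrix (Fin 3) (Fin 3) ℝ) (Set.range P))
  have h1V : (1 : Matrix (Fin 3) (Fin 3) ℝ) ∈ V := Submodule.subset_span (Set.mem_insert _ _)
  have hPV : ∀ x, P x ∈ V := fun x =>
    Submodule.subset_span (Set.mem_insert_of_mem _ (Set.mem_range_self x))
  -- every element of `V` has only real eigenvalues
  have hRSV : ∀ M ∈ V, ∀ z : ℂ,
      (M.map (algebraMap ℝ ℂ) - z • (1 : Matrix (Fin 3) (Fin 3) ℂ)).det = 0 → z.im = 0 := by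
    intro M hM z hz
    rw [Submodule.mem_span_insert] at hM
    obtain ⟨a, Q, hQ, rfl⟩ := hM
    have hQ' : Q ∈ LinearMap.range P :=
      (Submodule.span_le.mpr (Set.range_subset_iff.mpr fun x => LinearMap.mem_range_self P x)) hQ
    obtain ⟨x, rfl⟩ := LinearMap.mem_range.1 hQ'
    rw [permanentalCones_map_smul_one_add_sub] at hz
    have him := hP x (z - (a : ℂ)) hz
    rwa [Complex.sub_im, Complex.ofReal_im, sub_zero] at him
  -- a `4`-frame of `V` with linear coordinates
  obtain ⟨b, coord, hbV, hsum⟩ := permanentalCones_exists_frame_of_finrank_le V hdim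
  set e : Fin 4 → ℝ := coord ⟨1, h1V⟩
  have he1 : ∑ i, e i • b i = 1 := hsum ⟨1, h1V⟩
  set c : (Fin n → ℝ) →ₗ[ℝ] (Fin 4 → ℝ) := coord.comp (LinearMap.codRestrict V P hPV)
  have hcP : ∀ x, ∑ i, c x i • b i = P x := fun x => hsum ⟨P x, hPV x⟩
  -- the frame pencil has real spectrum, so stub T₄ applies, and then stub HKₑ
  have hRSb : ∀ (w : Fin 4 → ℝ) (z : ℂ),
      ((∑ i, w i • b i).map (algebraMap ℝ ℂ) - z • (1 : Matrix (Fin 3) (Fin 3) ℂ)).det = 0 →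
        z.im = 0 :=
    fun w z hz => hRSV _ (Submodule.sum_mem V fun i _ => Submodule.smul_mem V (w i) (hbV i)) z hz
  obtain ⟨F, hFhom, hFe, hFroots, hFeval⟩ := hT b e he1 hRSb
  obtain ⟨A, hAh, hAe, hAdet⟩ := hHK F e hFhom hFe hFroots
  -- the hermitian `ℝ`-linear pencil `H x = Σ cᵢ(x) Aᵢ`
  obtain ⟨H, hH⟩ : ∃ H : (Fin n → ℝ) →ₗ[ℝ] Matrix (Fin 3) (Fin 3) ℂ,
      ∀ x, H x = ∑ i, ((c x i : ℝ) : ℂ) • A i :=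
    ⟨(Fintype.linearCombination ℝ A).comp c, fun x => by
      rw [LinearMap.comp_apply, Fintype.linearCombination_apply]
      exact Finset.sum_congr rfl fun i _ => (algebraMap_smul ℂ (c x i) (A i)).symm⟩
  have hHerm : ∀ x : Fin n → ℝ, (H x).IsHermitian := fun x => by
    rw [hH, Matrix.IsHermitian, Matrix.conjTranspose_sum]
    refine Finset.sum_congr rfl fun i _ => ?_
    rw [Matrix.conjTranspose_smul, (hAh i).eq, Complex.star_def, Complex.conj_ofReal]
  -- the determinantal identity `det (H x + τ·1) = det (P x + τ·1)`
  have hdet : ∀ (x : Fin n → ℝ) (τ : ℝ), (H x + (τ : ℂ) • (1 : Matrix (Fin 3) (Fin 3) ℂ)).det =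
      (((P x + τ • (1 : Matrix (Fin 3) (Fin 3) ℝ)).det : ℝ) : ℂ) := fun x τ => by
    have h1 : P x + τ • (1 : Matrix (Fin 3) (Fin 3) ℝ) = ∑ i, (c x + τ • e) i • b i := by
      rw [← hcP x, ← he1, Finset.smul_sum, ← Finset.sum_add_distrib]
      refine Finset.sum_congr rfl fun i _ => ?_
      rw [Pi.add_apply, Pi.smul_apply, smul_eq_mul, add_smul, smul_smul]
    have h2 : H x + (τ : ℂ) • (1 : Matrix (Fin 3) (Fin 3) ℂ) =
        ∑ i, (((c x + τ • e) i : ℝ) : ℂ) • A i := by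
      rw [hH, ← hAe, Finset.smul_sum, ← Finset.sum_add_distrib]
      refine Finset.sum_congr rfl fun i _ => ?_
      rw [Pi.add_apply, Pi.smul_apply, smul_eq_mul, Complex.ofReal_add, Complex.ofReal_mul,
        add_smul, smul_smul]
    rw [h2, ← hAdet (c x + τ • e), hFeval (c x + τ • e), h1]
  -- realification: a symmetric pencil of size `2·3` representing the square of `det (P x + τ·1)`
  obtain ⟨L, hLsymm, hLdet⟩ := hR n 3 H hHerm
  have hLdet' : ∀ (x : Fin n → ℝ) (τ : ℝ),
      (L x + τ • (1 : Matrix (Fin (2 * 3)) (Fin (2 * 3)) ℝ)).det =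
        ((P x + τ • (1 : Matrix (Fin 3) (Fin 3) ℝ)).det) ^ 2 := fun x τ => by
    have h := hLdet x τ
    simp only [Complex.coe_algebraMap] at h
    have hs : star (((P x + τ • (1 : Matrix (Fin 3) (Fin 3) ℝ)).det : ℝ) : ℂ) =
        ((P x + τ • (1 : Matrix (Fin 3) (Fin 3) ℝ)).det : ℝ) := Complex.conj_ofReal _
    rw [hdet x τ, hs, ← Complex.ofReal_mul] at h
    rw [sq]
    exact_mod_cast h
  -- stub S⁺ with `k = 2`
  have h6 := hS n 3 (2 * 3) 2 P L two_ne_zero hLsymm hLdet'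
  exact h6

end Summit.ValiantsHypothesis.ValiantsHypothesis.Theorems
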